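import Literature.MathematicalPhysics.QuantumFieldTheory.Balaban1983to89.B12Spaces329NearSharp
import Literature.MathematicalPhysics.QuantumFieldTheory.Balaban1983to89.B12RegularSpaces111SpecialUnitary
import HarnessLib

/-!
# BalabanUVNodes ∕ node N18 = NE5 — closure-ledger item (iii), the (1.13) half of the comb-gauge step, FILE A (one bond ∕ one pair of bonds):
# THE NEW POTENTIAL AFTER A PURE `Gᶜ`-STEP `e = exp iξE` MINUS THE FIRST-ORDER SUM IS SECOND ORDER, IN CANCELLATION-READY FORM
# (Track A, DAG node N18 = `T4OutputRate.NE5` :211; cluster K4 «SpineRates», item K3⁷ `SpineGivenEndpointR13SepCoPH`; seat pub-ymgap-dag-n18-w3 g3)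

CREDIT.  This file and its two sequels (`…N18CombStepFirstOrderFrame`, `…N18CombStepOrbitFrame`) HOME the LENS seat's farm-checked scratch
`ym-lens-BalabanUVNodes-transfer` g32 `LensTransferSketch32.lean` (memo `LENS-transfer.md` §38, Card T49; bus 2026-08-27 [LENS-TRANSFER-G32-1]), per that
seat's close-out pointer «home the files `--kind proof --supports 20544 --as helper` WITH CREDIT» (g35, [LENS-TRANSFER-G35-0] (3)).  The mathematics and the
proofs of §0–§2 below are the lens's, re-checked against today's tree; the re-cut for the tree (file split, frames of record instead of a hypothesis
bundle) is this seat's.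

HONEST FRAMING.  Count-neutral kernel bookkeeping (`--supports stmt-QuantumFields-20544 --as helper`): pure Banach-algebra estimates over the tree's
near-(3.29) lineage (`B12Membership313II` · `B12Spaces329BCH` · `B12Spaces329NearBond` · `B12Spaces329Near` · `B12Spaces329NearSharp`, seat lit-balaban-p07),
PROVED; nothing here is a claim about NE5, N18, the continuum limit or the mass gap.  NE5 is NOT PRINTED and NOT proved; N18 is NOT discharged.

WHY.  Module 21 v1.1 (`Thm/BalabanUVNodesN18TransportClausesReduction` §4) ∕ `Thm/BalabanUVNodesN18TransportOfRecordCovariance` reduce N18's two transport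
clauses at the table of record to ONE displayed input `hsat`: (i)–(iii) of run B ⟹ (i)–(iii) of run A for SOME `Gᶜ`-gauge transform `act w (TΦ Φ)` of the
transported pair (ORBIT form; lens note [LENS-TRANSFER-G30-0] (2)).  The gauge is the complex comb gauge `w = exp(−λ̄)` ([Balaban1985Averaging] (62)–(63)):
a PURE `Gᶜ`-step `e = exp iξE`, `E = (i∕ξ)λ̄`, `|E| = O(d·α₁)` — NOT small against `α₁`.  The tree's «proper spaces» clause of (3.29)
(`B12Spaces329NearSharp.condII_near_sharp`) carries (ii) = (1.13) through `v = w·exp(iξE)` at the cost `α₁′ ≥ α₁ + (3 + 12α₁ + 3ξα₀)δ₀ + 4δ₁`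
(`|E| ≤ δ₀`, `|∇^ξ_U E| ≤ δ₁`), bounding the three first-order constituents `E(b₋)`, `A′(b)`, `−R(U(b))E(b₊)` of the new potential
`A″(b) = newPot ξ E(b₋) (newPot ξ A′(b) (−R(U(b))E(b₊)))` SEPARATELY — a level-INDEPENDENT relative loss `≥ 3δ₀∕α₁ = O(d)` for the comb gauge, not
inhabitable by the level-geometric slack of the radii family of record (family L).  The point of the comb gauge is that the first-order constituents CANCEL
against the comb term of `A′`: only their SUM `S(b) = E(b₋) + A′(b) − R(U(b))E(b₊) = A′(b) − ξ·(∇^ξ_{U,ν}E)(x)` (`= A′(b) − i·(∇^ξ_{U,ν}λ̄)(x)` for the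
comb gauge) is small.  The re-cut proves `|A″(b)| ≤ |S(b)| + 4ξδ₀(a + δ₀)` and `|∇^ξ_{U,μ}A″_ν(x)| ≤ |∇^ξ_{U,μ}S_ν(x)| + 4ξ·[(size)×(derivative) products]`
— every remainder carries a factor `ξ·(a + δ₀)` (relative `O(ξ·d·α₁)`, level-geometric) — by the IDENTITY `B12Membership313II.conj_newPot_sub_newPot_eq`
(twice) and the bilinear Lipschitz bound `B12Spaces329BCH.norm_bchRem_sub_bchRem_le_sharp` of the BCH remainder.

WHAT (this file: the bond-level algebra; the lattice statements at the frames of record are FILES B, C).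
* §0 `norm_newPot_le_of_le` (size of one BCH composition).
* §1 ★ `norm_newPot3_sub_firstOrder_le` — one bond: `‖A″ − S‖ ≤ 4ξδ(a + δ)`.
* §2 `conj_newPot3_sub_sub_firstOrder_eq` (identity: the covariant difference of `A″` minus that of `S` is `(iξ)⁻¹·(ΔG_out + ΔG_in)`),
  ★ `norm_covD_newPot3_sub_covD_firstOrder_le` (its norm: `≤ 4ξ(δ·d_A + a·d_T) + 4ξ((a + 9δ∕8)·d_E + δ((1+4ξδ)d_A + (1+4ξa)d_T))`).
* §3 pointwise lattice algebra: `nabla_const_smul`, `firstOrder_eq` (`S = A′ − ξ•∇^ξ_U E` at a bond), `expI_comb` (`exp iξ((i∕ξ)•l) = exp(−l)`),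
  `firstOrder_comb` (`S = A′ − i•∇^ξ_U l` for the comb gauge).

0 `def`, 0 `sorry`.  References: T. Bałaban, CMP **109** (1987) 249–301 [Balaban1987RG1] ((1.13) p.262, (3.29) p.281); CMP **98** (1985) 17–51
[Balaban1985Averaging] ((62)–(63) p.29); CMP **99** (1985) 389–434 [Balaban1985PropagatorsBackground] ((3.1)–(3.3) p.393).
-/

namespace YMDAG.N18.CombStep

open NormedSpace
open Literature.MathematicalPhysics.QuantumFieldTheory.Balaban1983to89
open Literature.MathematicalPhysics.QuantumFieldTheory.Balaban1983to89.B12RegularSpaces111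
open Literature.MathematicalPhysics.QuantumFieldTheory.Balaban1983to89.B12RegularSpaces111Gauge
open Literature.MathematicalPhysics.QuantumFieldTheory.Balaban1983to89.B12RegularSpaces111Mono
open Literature.MathematicalPhysics.QuantumFieldTheory.Balaban1983to89.B12Membership314
open Literature.MathematicalPhysics.QuantumFieldTheory.Balaban1983to89.B12Membership313II
open Literature.MathematicalPhysics.QuantumFieldTheory.Balaban1983to89.B12Spaces329BCH
open Literature.MathematicalPhysics.QuantumFieldTheory.Balaban1983to89.B12Spaces329NearBond
open Literature.MathematicalPhysics.QuantumFieldTheory.Balaban1983to89.B12Spaces329Near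
open Literature.MathematicalPhysics.QuantumFieldTheory.Balaban1983to89.B12Spaces329NearSharp
open Complex (I)

noncomputable section

variable {𝔸 : Type*} [NormedRing 𝔸] [NormedAlgebra ℂ 𝔸] [CompleteSpace 𝔸]

/-! ## §0. Helpers -/

/-- Size and range of one BCH composition `N = newPot ξ A T` with `|A| ≤ a`, `|T| ≤ δ`, `ξ(a + 2δ) ≤ 1/16`:
`ξ(|A| + |T|) ≤ 1/16` and `|N| ≤ a + (9/8)δ` (`norm_newPot_le_sharp`). -/
theorem norm_newPot_le_of_le {ξ a δ : ℝ} (hξ : 0 < ξ) (ha : 0 ≤ a) (hδ : 0 ≤ δ) (hs : ξ * (a + 2 * δ) ≤ 1 / 16)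
    {A T : 𝔸} (hA : ‖A‖ ≤ a) (hT : ‖T‖ ≤ δ) :
    ξ * (‖A‖ + ‖T‖) ≤ 1 / 16 ∧ ‖newPot ξ A T‖ ≤ a + (9 / 8) * δ := by
  have h1 : ξ * (‖A‖ + ‖T‖) ≤ 1 / 16 := by nlinarith [norm_nonneg A, norm_nonneg T]
  have hN := norm_newPot_le_sharp hξ (h1.trans (by norm_num))
  have hξa : ξ * a ≤ 1 / 16 := by nlinarith
  have h2 : 2 * ξ * ‖A‖ * ‖T‖ ≤ 2 * ξ * a * δ := by
    have := mul_le_mul hA hT (norm_nonneg _) ha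
    nlinarith [hξ.le]
  refine ⟨h1, hN.trans ?_⟩
  nlinarith

/-! ## §1. One bond: the new potential minus the first-order sum is second order, `‖A″ − S‖ ≤ 4ξδ(a + δ)` -/

/-- **One bond, sup letter.**  `A″ = newPot ξ E₀ (newPot ξ A T)`, `T = U(−E₁)U⁻¹` (`U ∈ G`, `‖·‖ ≤ 1` on `G`), `|E₀|, |E₁| ≤ δ`, `|A| ≤ a`,
`ξ(a + 2δ) ≤ 1/16`: `‖A″ − (E₀ + A + T)‖ ≤ 2ξ|A||T| + 2ξ|E₀||newPot ξ A T| ≤ 4ξδ(a + δ)` (`norm_newPot_sub_add_le`, twice). -/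
theorem norm_newPot3_sub_firstOrder_le {G : Subgroup 𝔸ˣ} (hG1 : ∀ g ∈ G, ‖(g : 𝔸)‖ ≤ 1) {ξ a δ : ℝ} (hξ : 0 < ξ)
    (ha : 0 ≤ a) (hδ : 0 ≤ δ) (hs : ξ * (a + 2 * δ) ≤ 1 / 16) {U : 𝔸ˣ} (hU : U ∈ G) {E₀ E₁ A : 𝔸} (hE₀ : ‖E₀‖ ≤ δ)
    (hE₁ : ‖E₁‖ ≤ δ) (hA : ‖A‖ ≤ a) :
    ‖newPot ξ E₀ (newPot ξ A ((U : 𝔸) * (-E₁) * ↑U⁻¹)) - (E₀ + A + (U : 𝔸) * (-E₁) * ↑U⁻¹)‖ ≤ 4 * ξ * δ * (a + δ) := by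
  set T := (U : 𝔸) * (-E₁) * ↑U⁻¹ with hT
  have hTn : ‖T‖ ≤ δ := by rw [hT, norm_conj_eq hG1 hU, norm_neg]; exact hE₁
  obtain ⟨h1, hN⟩ := norm_newPot_le_of_le hξ ha hδ hs hA hTn
  set N := newPot ξ A T with hNdef
  have hξa : ξ * a ≤ 1 / 16 := by nlinarith
  have hξδ : ξ * δ ≤ 1 / 32 := by nlinarith
  have h2 : ξ * (‖E₀‖ + ‖N‖) ≤ 1 / 5 := by
    have h0 : ‖E₀‖ + ‖N‖ ≤ a + (17 / 8) * δ := by linarith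
    have : ξ * (‖E₀‖ + ‖N‖) ≤ ξ * (a + (17 / 8) * δ) := mul_le_mul_of_nonneg_left h0 hξ.le
    nlinarith
  have hin : ‖N - (A + T)‖ ≤ 2 * ξ * a * δ := by
    refine (norm_newPot_sub_add_le hξ (h1.trans (by norm_num))).trans ?_
    have := mul_le_mul hA hTn (norm_nonneg _) ha
    nlinarith [hξ.le]
  have hout : ‖newPot ξ E₀ N - (E₀ + N)‖ ≤ 2 * ξ * δ * (a + (9 / 8) * δ) := by
    refine (norm_newPot_sub_add_le hξ h2).trans ?_
    have := mul_le_mul hE₀ hN (norm_nonneg _) hδ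
    nlinarith [hξ.le]
  have hsplit : newPot ξ E₀ N - (E₀ + A + T) = (newPot ξ E₀ N - (E₀ + N)) + (N - (A + T)) := by abel
  rw [hsplit]
  refine (norm_add_le_of_le hout hin).trans ?_
  nlinarith [mul_nonneg hξ.le (mul_nonneg hδ hδ)]

/-! ## §2. One pair of bonds: the covariant difference of `A″` minus that of `S` is `(iξ)⁻¹(ΔG_out + ΔG_in)` -/

/-- **The identity.**  With `N_k = newPot ξ A_k T_k`, `A″_k = newPot ξ X_k N_k` (`k = 0, 1`), `S_k = X_k + A_k + T_k` and a unit `u` (the transporter):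
`(uA″₁u⁻¹ − A″₀) − (uS₁u⁻¹ − S₀) = (iξ)⁻¹·(ΔG_out + ΔG_in)`, `ΔG_out = G(iξ·uX₁u⁻¹, iξ·uN₁u⁻¹) − G(iξX₀, iξN₀)`,
`ΔG_in = G(iξ·uA₁u⁻¹, iξ·uT₁u⁻¹) − G(iξA₀, iξT₀)`, `G(X, Y) = bchLog X Y − (X + Y)` (`conj_newPot_sub_newPot_eq`, twice). -/
theorem conj_newPot3_sub_sub_firstOrder_eq (u : 𝔸ˣ) {ξ : ℝ} (hξ : ξ ≠ 0) {X₀ X₁ A₀ A₁ T₀ T₁ : 𝔸}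
    (hin : ‖exp ((I * ξ) • A₁) * exp ((I * ξ) • T₁) - 1‖ < 1)
    (hout : ‖exp ((I * ξ) • X₁) * exp ((I * ξ) • newPot ξ A₁ T₁) - 1‖ < 1) :
    ((u : 𝔸) * newPot ξ X₁ (newPot ξ A₁ T₁) * ↑u⁻¹ - newPot ξ X₀ (newPot ξ A₀ T₀)) -
        ((u : 𝔸) * (X₁ + A₁ + T₁) * ↑u⁻¹ - (X₀ + A₀ + T₀)) =
      (I * ξ)⁻¹ •
        (((bchLog ((I * ξ) • ((u : 𝔸) * X₁ * ↑u⁻¹)) ((I * ξ) • ((u : 𝔸) * newPot ξ A₁ T₁ * ↑u⁻¹)) -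
              ((I * ξ) • ((u : 𝔸) * X₁ * ↑u⁻¹) + (I * ξ) • ((u : 𝔸) * newPot ξ A₁ T₁ * ↑u⁻¹))) -
            (bchLog ((I * ξ) • X₀) ((I * ξ) • newPot ξ A₀ T₀) - ((I * ξ) • X₀ + (I * ξ) • newPot ξ A₀ T₀))) +
          ((bchLog ((I * ξ) • ((u : 𝔸) * A₁ * ↑u⁻¹)) ((I * ξ) • ((u : 𝔸) * T₁ * ↑u⁻¹)) -
              ((I * ξ) • ((u : 𝔸) * A₁ * ↑u⁻¹) + (I * ξ) • ((u : 𝔸) * T₁ * ↑u⁻¹))) -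
            (bchLog ((I * ξ) • A₀) ((I * ξ) • T₀) - ((I * ξ) • A₀ + (I * ξ) • T₀)))) := by
  have h1 := conj_newPot_sub_newPot_eq u hξ (A := X₀) (A' := newPot ξ A₀ T₀) hout
  have h2 := conj_newPot_sub_newPot_eq u hξ (A := A₀) (A' := T₀) hin
  rw [h1, h2, smul_add]
  simp only [mul_add, add_mul]
  abel

/-- **The norm of the identity.**  If `u, ` the conjugating units are in `G` (`‖·‖ ≤ 1` on `G`), `|X_k|, |T_k| ≤ δ`, `|A_k| ≤ a`, `ξ(a + 2δ) ≤ 1/16`,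
then with `d_Y = ‖ξ⁻¹(uY₁u⁻¹ − Y₀)‖` (`Y = X, A, T`):
`‖ξ⁻¹((uA″₁u⁻¹ − A″₀) − (uS₁u⁻¹ − S₀))‖ ≤ 4ξ(δ·d_A + a·d_T) + 4ξ((a + 9δ/8)·d_X + δ·((1 + 4ξδ)d_A + (1 + 4ξa)d_T))`
— every term is `ξ × (a size) × (a derivative letter)` (`norm_bchRem_sub_bchRem_le_sharp` twice, `norm_covD_newPot_le_sharp` for `d_N`). -/
theorem norm_covD_newPot3_sub_covD_firstOrder_le {G : Subgroup 𝔸ˣ} (hG1 : ∀ g ∈ G, ‖(g : 𝔸)‖ ≤ 1) {ξ a δ : ℝ} (hξ : 0 < ξ)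
    (ha : 0 ≤ a) (hδ : 0 ≤ δ) (hs : ξ * (a + 2 * δ) ≤ 1 / 16) {u : 𝔸ˣ} (hu : u ∈ G) {X₀ X₁ A₀ A₁ T₀ T₁ : 𝔸}
    (hX₀ : ‖X₀‖ ≤ δ) (hX₁ : ‖X₁‖ ≤ δ) (hA₀ : ‖A₀‖ ≤ a) (hA₁ : ‖A₁‖ ≤ a) (hT₀ : ‖T₀‖ ≤ δ) (hT₁ : ‖T₁‖ ≤ δ) :
    ‖(ξ : ℂ)⁻¹ • (((u : 𝔸) * newPot ξ X₁ (newPot ξ A₁ T₁) * ↑u⁻¹ - newPot ξ X₀ (newPot ξ A₀ T₀)) -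
        ((u : 𝔸) * (X₁ + A₁ + T₁) * ↑u⁻¹ - (X₀ + A₀ + T₀)))‖ ≤
      4 * ξ * (δ * ‖(ξ : ℂ)⁻¹ • ((u : 𝔸) * A₁ * ↑u⁻¹ - A₀)‖ + a * ‖(ξ : ℂ)⁻¹ • ((u : 𝔸) * T₁ * ↑u⁻¹ - T₀)‖) +
        4 * ξ * ((a + (9 / 8) * δ) * ‖(ξ : ℂ)⁻¹ • ((u : 𝔸) * X₁ * ↑u⁻¹ - X₀)‖ +
          δ * ((1 + 4 * (ξ * δ)) * ‖(ξ : ℂ)⁻¹ • ((u : 𝔸) * A₁ * ↑u⁻¹ - A₀)‖ +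
            (1 + 4 * (ξ * a)) * ‖(ξ : ℂ)⁻¹ • ((u : 𝔸) * T₁ * ↑u⁻¹ - T₀)‖)) := by
  -- conjugated sizes
  have hX₁' : ‖(u : 𝔸) * X₁ * ↑u⁻¹‖ ≤ δ := by rw [norm_conj_eq hG1 hu]; exact hX₁
  have hA₁' : ‖(u : 𝔸) * A₁ * ↑u⁻¹‖ ≤ a := by rw [norm_conj_eq hG1 hu]; exact hA₁
  have hT₁' : ‖(u : 𝔸) * T₁ * ↑u⁻¹‖ ≤ δ := by rw [norm_conj_eq hG1 hu]; exact hT₁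
  have hξa : ξ * a ≤ 1 / 16 := by nlinarith
  have hξδ : ξ * δ ≤ 1 / 32 := by nlinarith
  -- the inner compositions
  obtain ⟨hr₀, hN₀⟩ := norm_newPot_le_of_le hξ ha hδ hs hA₀ hT₀
  obtain ⟨hr₁, hN₁⟩ := norm_newPot_le_of_le hξ ha hδ hs hA₁ hT₁
  set N₀ := newPot ξ A₀ T₀ with hN₀def
  set N₁ := newPot ξ A₁ T₁ with hN₁def
  have hN₁' : ‖(u : 𝔸) * N₁ * ↑u⁻¹‖ ≤ a + (9 / 8) * δ := by rw [norm_conj_eq hG1 hu]; exact hN₁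
  have hin : ‖exp ((I * ξ) • A₁) * exp ((I * ξ) • T₁) - 1‖ < 1 :=
    norm_expI_prod_sub_one_lt_one hξ.le (hr₁.trans (by norm_num))
  have hout : ‖exp ((I * ξ) • X₁) * exp ((I * ξ) • N₁) - 1‖ < 1 := by
    refine norm_expI_prod_sub_one_lt_one hξ.le ?_
    have : ξ * (‖X₁‖ + ‖N₁‖) ≤ ξ * (δ + (a + (9 / 8) * δ)) := mul_le_mul_of_nonneg_left (add_le_add hX₁ hN₁) hξ.le
    nlinarith
  -- abbreviations for the derivative letters
  set dX := ‖(ξ : ℂ)⁻¹ • ((u : 𝔸) * X₁ * ↑u⁻¹ - X₀)‖ with hdX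
  set dA := ‖(ξ : ℂ)⁻¹ • ((u : 𝔸) * A₁ * ↑u⁻¹ - A₀)‖ with hdA
  set dT := ‖(ξ : ℂ)⁻¹ • ((u : 𝔸) * T₁ * ↑u⁻¹ - T₀)‖ with hdT
  set dN := ‖(ξ : ℂ)⁻¹ • ((u : 𝔸) * N₁ * ↑u⁻¹ - N₀)‖ with hdN
  -- `d_N ≤ (1+4ξδ)d_A + (1+4ξa)d_T`
  have hdNle : dN ≤ (1 + 4 * (ξ * δ)) * dA + (1 + 4 * (ξ * a)) * dT := by
    have hr : ξ * a + ξ * δ ≤ 1 / 8 := by nlinarith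
    exact norm_covD_newPot_le_sharp u hξ hin (mul_le_mul_of_nonneg_left hA₀ hξ.le)
      (mul_le_mul_of_nonneg_left hA₁' hξ.le) (mul_le_mul_of_nonneg_left hT₀ hξ.le)
      (mul_le_mul_of_nonneg_left hT₁' hξ.le) hr
  -- the identity
  rw [conj_newPot3_sub_sub_firstOrder_eq u hξ.ne' hin hout]
  set ΔGout := (bchLog ((I * ξ) • ((u : 𝔸) * X₁ * ↑u⁻¹)) ((I * ξ) • ((u : 𝔸) * N₁ * ↑u⁻¹)) -
        ((I * ξ) • ((u : 𝔸) * X₁ * ↑u⁻¹) + (I * ξ) • ((u : 𝔸) * N₁ * ↑u⁻¹))) -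
      (bchLog ((I * ξ) • X₀) ((I * ξ) • N₀) - ((I * ξ) • X₀ + (I * ξ) • N₀)) with hΔGout
  set ΔGin := (bchLog ((I * ξ) • ((u : 𝔸) * A₁ * ↑u⁻¹)) ((I * ξ) • ((u : 𝔸) * T₁ * ↑u⁻¹)) -
        ((I * ξ) • ((u : 𝔸) * A₁ * ↑u⁻¹) + (I * ξ) • ((u : 𝔸) * T₁ * ↑u⁻¹))) -
      (bchLog ((I * ξ) • A₀) ((I * ξ) • T₀) - ((I * ξ) • A₀ + (I * ξ) • T₀)) with hΔGin
  -- norms via the bilinear Lipschitz bound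
  have e1 : ∀ Y₁ Y₀ : 𝔸, ‖(I * ξ) • Y₁ - (I * ξ) • Y₀‖ = ξ * (ξ * ‖(ξ : ℂ)⁻¹ • (Y₁ - Y₀)‖) := fun Y₁ Y₀ => by
    rw [← smul_sub, norm_I_mul_smul hξ.le, norm_eq_mul_norm_inv_smul hξ (Y₁ - Y₀)]
  have hGin : ‖ΔGin‖ ≤ 4 * (ξ * δ * (ξ * (ξ * dA)) + ξ * a * (ξ * (ξ * dT))) := by
    have h := norm_bchRem_sub_bchRem_le_sharp (X₁ := (I * ξ) • ((u : 𝔸) * A₁ * ↑u⁻¹)) (X₂ := (I * ξ) • A₀)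
      (Y₁ := (I * ξ) • ((u : 𝔸) * T₁ * ↑u⁻¹)) (Y₂ := (I * ξ) • T₀) (a := ξ * a) (a' := ξ * δ)
      (by rw [norm_I_mul_smul hξ.le]; exact mul_le_mul_of_nonneg_left hA₁' hξ.le)
      (by rw [norm_I_mul_smul hξ.le]; exact mul_le_mul_of_nonneg_left hA₀ hξ.le)
      (by rw [norm_I_mul_smul hξ.le]; exact mul_le_mul_of_nonneg_left hT₁' hξ.le)
      (by rw [norm_I_mul_smul hξ.le]; exact mul_le_mul_of_nonneg_left hT₀ hξ.le) (by nlinarith)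
    rw [e1, e1, ← hdA, ← hdT] at h
    exact h
  have hGout : ‖ΔGout‖ ≤ 4 * (ξ * (a + (9 / 8) * δ) * (ξ * (ξ * dX)) + ξ * δ * (ξ * (ξ * dN))) := by
    have h := norm_bchRem_sub_bchRem_le_sharp (X₁ := (I * ξ) • ((u : 𝔸) * X₁ * ↑u⁻¹)) (X₂ := (I * ξ) • X₀)
      (Y₁ := (I * ξ) • ((u : 𝔸) * N₁ * ↑u⁻¹)) (Y₂ := (I * ξ) • N₀) (a := ξ * δ) (a' := ξ * (a + (9 / 8) * δ))
      (by rw [norm_I_mul_smul hξ.le]; exact mul_le_mul_of_nonneg_left hX₁' hξ.le)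
      (by rw [norm_I_mul_smul hξ.le]; exact mul_le_mul_of_nonneg_left hX₀ hξ.le)
      (by rw [norm_I_mul_smul hξ.le]; exact mul_le_mul_of_nonneg_left hN₁' hξ.le)
      (by rw [norm_I_mul_smul hξ.le]; exact mul_le_mul_of_nonneg_left hN₀ hξ.le) (by nlinarith)
    rw [e1, e1, ← hdX, ← hdN] at h
    exact h
  have hGout' : ‖ΔGout‖ ≤
      4 * (ξ * (a + (9 / 8) * δ) * (ξ * (ξ * dX)) + ξ * δ * (ξ * (ξ * ((1 + 4 * (ξ * δ)) * dA + (1 + 4 * (ξ * a)) * dT)))) := by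
    refine hGout.trans ?_
    gcongr
  -- assemble
  rw [norm_smul, norm_I_mul_inv_smul hξ, norm_inv, Complex.norm_real, Real.norm_eq_abs, abs_of_pos hξ]
  calc ξ⁻¹ * (ξ⁻¹ * ‖ΔGout + ΔGin‖)
      ≤ ξ⁻¹ * (ξ⁻¹ * (4 * (ξ * (a + (9 / 8) * δ) * (ξ * (ξ * dX)) +
            ξ * δ * (ξ * (ξ * ((1 + 4 * (ξ * δ)) * dA + (1 + 4 * (ξ * a)) * dT)))) +
          4 * (ξ * δ * (ξ * (ξ * dA)) + ξ * a * (ξ * (ξ * dT))))) := by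
        gcongr
        exact norm_add_le_of_le hGout' hGin
    _ = 4 * ξ * (δ * dA + a * dT) + 4 * ξ * ((a + (9 / 8) * δ) * dX + δ * ((1 + 4 * (ξ * δ)) * dA + (1 + 4 * (ξ * a)) * dT)) := by
        field_simp
        ring

/-! ## §3 Pointwise lattice algebra: the first-order sum, the comb gauge's step -/

section Lattice

variable {P : Params} {i : ℕ}

omit [CompleteSpace 𝔸] in
/-- `∇^ξ_U` is `ℂ`-linear in the field: `∇^ξ_{U,μ}(c•l) = c•∇^ξ_{U,μ}l`. -/
theorem nabla_const_smul (ξ : ℝ) (U : PBond P i → 𝔸ˣ) (μ : Fin P.d) (c : ℂ) (l : Site P i → 𝔸) (x : Site P i) :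
    nabla ξ U μ (fun y => c • l y) x = c • nabla ξ U μ l x := by
  simp only [nabla, units_conj_smul, ← smul_sub, smul_comm ((ξ : ℂ)⁻¹) c]

omit [CompleteSpace 𝔸] in
/-- **The first-order sum is `A′ − ξ•∇^ξ_U E`**: at the bond `b = ⟨x, ν⟩`, `E(x) + U(b)(−E(x+ν))U(b)⁻¹ = −ξ•(∇^ξ_{U,ν}E)(x)`. -/
theorem firstOrder_eq {ξ : ℝ} (hξ : ξ ≠ 0) (U : PBond P i → 𝔸ˣ) (E : Site P i → 𝔸) (x : Site P i) (ν : Fin P.d) :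
    E x + (U ⟨x, ν⟩ : 𝔸) * (-E (x.shift ν)) * ↑(U ⟨x, ν⟩)⁻¹ = -((ξ : ℂ) • nabla ξ U ν E x) := by
  rw [nabla, smul_smul, mul_inv_cancel₀ (Complex.ofReal_ne_zero.mpr hξ), one_smul]
  noncomm_ring

/-- `exp iξ((i/ξ)•a) = exp(−a)` as units (`ξ ≠ 0`). -/
theorem expI_comb {ξ : ℝ} (hξ : ξ ≠ 0) (a : 𝔸) :
    expI ξ ((I * (ξ : ℂ)⁻¹) • a) = Beta.BackgroundVertices.expUnit ℂ (-a) := by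
  have hξ' : (ξ : ℂ) ≠ 0 := Complex.ofReal_ne_zero.mpr hξ
  have hc : (I * (ξ : ℂ)) * (I * (ξ : ℂ)⁻¹) = -1 := by
    rw [mul_mul_mul_comm, Complex.I_mul_I, mul_inv_cancel₀ hξ', neg_one_mul]
  unfold expI
  rw [smul_smul, hc, neg_one_smul]

omit [CompleteSpace 𝔸] in
/-- **The comb gauge's first-order sum**: with `E = (i/ξ)•l`, at the bond `⟨x, ν⟩`: `E(x) + U(−E(x+ν))U⁻¹ = −i•(∇^ξ_{U,ν}l)(x)`, so that
`S = A′ − i•∇^ξ_U l` («`A‴ = A″ − i∇^ξ_Ū λ̄ + second order`»: the comb term `(i/ξ)dλ̄` of `A″` is cancelled up to `(i/ξ)(R(Ū) − 1)λ̄`). -/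
theorem firstOrder_comb {ξ : ℝ} (hξ : ξ ≠ 0) (U : PBond P i → 𝔸ˣ) (l : Site P i → 𝔸) (x : Site P i) (ν : Fin P.d) :
    (I * (ξ : ℂ)⁻¹) • l x + (U ⟨x, ν⟩ : 𝔸) * (-((I * (ξ : ℂ)⁻¹) • l (x.shift ν))) * ↑(U ⟨x, ν⟩)⁻¹ =
      -(I • nabla ξ U ν l x) := by
  have hξ' : (ξ : ℂ) ≠ 0 := Complex.ofReal_ne_zero.mpr hξ
  have h := firstOrder_eq hξ U (fun y => (I * (ξ : ℂ)⁻¹) • l y) x ν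
  rw [h, nabla_const_smul, smul_smul]
  congr 2
  rw [mul_left_comm, mul_inv_cancel₀ hξ', mul_one]

end Lattice

end

end YMDAG.N18.CombStep
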